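import Mathlib
import HarnessLib

/-!
# `NoHeavyLowerTail` (stmt-CriticalPhenomena-4575), line fat-minority-linear — the finite LAYER CAKE
# (Abel summation) over up-sets of star patterns (route task `nh-dp-fatminority`, gen 11)

A purely combinatorial lemma used twice in the paper chain of the notes (PROOF-UT4-upto3ports.md):
in THEOREM C (`UT4 on every up-set ⟹ RT4`, step (C3)) and in the slack edge lemma (B1).  If a function
`H` on a finite family `𝒜` of finsets has NONPOSITIVE sums over every sub-family of `𝒜` that is up-closed
inside `𝒜`, and `κ` is monotone and nonnegative on `𝒜`, then `Σ_{B ∈ 𝒜} κ(B) · H(B) ≤ 0`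
(`upsetLayerCake_sum_nonpos`): write `κ = Σ_j (κ_j − κ_{j−1}) · 1{κ ≥ κ_j}` and note that every
`{κ ≥ κ_j}` is up-closed.  The signed form with a budget, `Σ_{B∈𝒰} H ≤ t · Σ_{B∈𝒰} π` on every up-closed
`𝒰` and `0 ≤ κ ≤ 1`, `π ≥ 0`, `t ≥ 0` `⟹ Σ κ H ≤ t · Σ π` (`upsetLayerCake_sum_le`), is the shape consumed
by the edge lemma.  No definitions, no measure theory.
-/

namespace Summit.CriticalPhenomena.PercolationContinuityZ3.Theorems

open Finset

/-- **Finite layer cake over up-closed families.**  Let `𝒜` be a finite family of finsets, `H κ : Finset α → ℝ`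
with `κ ≥ 0` and `κ` monotone on `𝒜` (w.r.t. `⊆`), and suppose `Σ_{B ∈ 𝒰} H(B) ≤ 0` for every `𝒰 ⊆ 𝒜`
that is up-closed inside `𝒜`.  Then `Σ_{B ∈ 𝒜} κ(B) · H(B) ≤ 0`.  Proof: induction on the number of
`B ∈ 𝒜` with `κ(B) > 0`; subtract `m · 1{κ > 0}` with `m = min {κ(B) : κ(B) > 0}` — the family `{κ > 0}`
is up-closed. [folklore: Abel summation / layer-cake formula] -/
theorem upsetLayerCake_sum_nonpos {α : Type*} [DecidableEq α] (𝒜 : Finset (Finset α))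
    (H κ : Finset α → ℝ) (hκ0 : ∀ B ∈ 𝒜, 0 ≤ κ B)
    (hκmono : ∀ B ∈ 𝒜, ∀ B' ∈ 𝒜, B ⊆ B' → κ B ≤ κ B')
    (hH : ∀ 𝒰 ⊆ 𝒜, (∀ B ∈ 𝒰, ∀ B' ∈ 𝒜, B ⊆ B' → B' ∈ 𝒰) → ∑ B ∈ 𝒰, H B ≤ 0) :
    ∑ B ∈ 𝒜, κ B * H B ≤ 0 := by
  classical
  suffices key : ∀ (m : ℕ) (κ : Finset α → ℝ), (𝒜.filter (fun B => 0 < κ B)).card = m →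
      (∀ B ∈ 𝒜, 0 ≤ κ B) → (∀ B ∈ 𝒜, ∀ B' ∈ 𝒜, B ⊆ B' → κ B ≤ κ B') →
      ∑ B ∈ 𝒜, κ B * H B ≤ 0 from key _ κ rfl hκ0 hκmono
  intro m
  induction m using Nat.strong_induction_on with
  | _ m ih =>
    intro κ hm hκ0 hκmono
    set P : Finset (Finset α) := 𝒜.filter (fun B => 0 < κ B) with hP
    rcases P.eq_empty_or_nonempty with hPe | hPne
    · -- `κ = 0` on `𝒜`
      have hz : ∀ B ∈ 𝒜, κ B = 0 := by
        intro B hB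
        have hnot : ¬ 0 < κ B := by
          intro hpos
          have : B ∈ P := Finset.mem_filter.2 ⟨hB, hpos⟩
          rw [hPe] at this
          exact Finset.notMem_empty B this
        exact le_antisymm (not_lt.1 hnot) (hκ0 B hB)
      have : ∑ B ∈ 𝒜, κ B * H B = 0 :=
        Finset.sum_eq_zero fun B hB => by rw [hz B hB, zero_mul]
      rw [this]
    · obtain ⟨B₀, hB₀P, hmin⟩ := Finset.exists_min_image P κ hPne
      have hB₀𝒜 : B₀ ∈ 𝒜 := (Finset.mem_filter.1 hB₀P).1
      set m0 : ℝ := κ B₀ with hm0def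
      have hm0 : 0 < m0 := (Finset.mem_filter.1 hB₀P).2
      -- the reduced function
      set κ' : Finset α → ℝ := fun B => if 0 < κ B then κ B - m0 else 0 with hκ'
      have hκ'0 : ∀ B ∈ 𝒜, 0 ≤ κ' B := by
        intro B hB
        simp only [hκ']
        split_ifs with h
        · have := hmin B (Finset.mem_filter.2 ⟨hB, h⟩)
          linarith
        · exact le_refl _
      have hκ'mono : ∀ B ∈ 𝒜, ∀ B' ∈ 𝒜, B ⊆ B' → κ' B ≤ κ' B' := by
        intro B hB B' hB' hBB'
        have hle := hκmono B hB B' hB' hBB'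
        by_cases h : 0 < κ B
        · have h' : 0 < κ B' := lt_of_lt_of_le h hle
          simp only [hκ', if_pos h, if_pos h']
          linarith
        · simp only [hκ', if_neg h]
          exact hκ'0 B' hB'
      -- decomposition `κ = κ' + m0 · 1_P` on `𝒜`
      have hsum : ∑ B ∈ 𝒜, κ B * H B = ∑ B ∈ 𝒜, κ' B * H B + m0 * ∑ B ∈ P, H B := by
        rw [hP, Finset.sum_filter, Finset.mul_sum, ← Finset.sum_add_distrib]
        refine Finset.sum_congr rfl fun B hB => ?_
        simp only [hκ']
        split_ifs with h
        · ring
        · have h0 : κ B = 0 := le_antisymm (not_lt.1 h) (hκ0 B hB)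
          rw [h0]; ring
      -- `P` is up-closed inside `𝒜`
      have hPup : ∀ B ∈ P, ∀ B' ∈ 𝒜, B ⊆ B' → B' ∈ P := by
        intro B hB B' hB' hBB'
        obtain ⟨hB𝒜, hpos⟩ := Finset.mem_filter.1 hB
        exact Finset.mem_filter.2 ⟨hB', lt_of_lt_of_le hpos (hκmono B hB𝒜 B' hB' hBB')⟩
      have hPsum : ∑ B ∈ P, H B ≤ 0 := hH P (Finset.filter_subset _ _) hPup
      -- strictly fewer positive points
      have hcard : (𝒜.filter (fun B => 0 < κ' B)).card < m := by
        rw [← hm]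
        apply Finset.card_lt_card
        rw [Finset.ssubset_iff_subset_ne]
        refine ⟨fun B hB => ?_, fun heq => ?_⟩
        · obtain ⟨hB𝒜, hpos⟩ := Finset.mem_filter.1 hB
          refine Finset.mem_filter.2 ⟨hB𝒜, ?_⟩
          by_contra h
          simp only [hκ', if_neg h, lt_self_iff_false] at hpos
        · have hmem : B₀ ∈ 𝒜.filter (fun B => 0 < κ' B) := by rw [heq]; exact hB₀P
          have hpos := (Finset.mem_filter.1 hmem).2
          have hzero : κ' B₀ = 0 := by
            have hm0' : 0 < κ B₀ := hm0
            simp only [hκ', if_pos hm0', hm0def, sub_self]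
          rw [hzero] at hpos
          exact lt_irrefl _ hpos
      have hIH := ih _ hcard κ' rfl hκ'0 hκ'mono
      rw [hsum]
      nlinarith [hIH, hPsum, hm0]

/-- **Layer cake with a budget.**  If `Σ_{B∈𝒰} H(B) ≤ t · Σ_{B∈𝒰} π(B)` for every up-closed `𝒰 ⊆ 𝒜`, with
`t ≥ 0`, `π ≥ 0` and `0 ≤ κ ≤ 1` monotone on `𝒜`, then `Σ_{B∈𝒜} κ(B) H(B) ≤ t · Σ_{B∈𝒜} π(B)`.
(Apply `upsetLayerCake_sum_nonpos` to `H − t·π` and use `κ π ≤ π`.) [folklore: Abel summation] -/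
theorem upsetLayerCake_sum_le {α : Type*} [DecidableEq α] (𝒜 : Finset (Finset α))
    (H κ π : Finset α → ℝ) (t : ℝ) (ht : 0 ≤ t) (hπ : ∀ B ∈ 𝒜, 0 ≤ π B)
    (hκ0 : ∀ B ∈ 𝒜, 0 ≤ κ B) (hκ1 : ∀ B ∈ 𝒜, κ B ≤ 1)
    (hκmono : ∀ B ∈ 𝒜, ∀ B' ∈ 𝒜, B ⊆ B' → κ B ≤ κ B')
    (hH : ∀ 𝒰 ⊆ 𝒜, (∀ B ∈ 𝒰, ∀ B' ∈ 𝒜, B ⊆ B' → B' ∈ 𝒰) →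
      ∑ B ∈ 𝒰, H B ≤ t * ∑ B ∈ 𝒰, π B) :
    ∑ B ∈ 𝒜, κ B * H B ≤ t * ∑ B ∈ 𝒜, π B := by
  classical
  have key := upsetLayerCake_sum_nonpos 𝒜 (fun B => H B - t * π B) κ hκ0 hκmono (by
    intro 𝒰 h𝒰 hup
    have := hH 𝒰 h𝒰 hup
    rw [Finset.sum_sub_distrib, ← Finset.mul_sum]
    linarith)
  have hsplit : ∑ B ∈ 𝒜, κ B * (H B - t * π B) =
      ∑ B ∈ 𝒜, κ B * H B - t * ∑ B ∈ 𝒜, κ B * π B := by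
    rw [Finset.mul_sum, ← Finset.sum_sub_distrib]
    refine Finset.sum_congr rfl fun B _ => by ring
  rw [hsplit] at key
  have hle : ∑ B ∈ 𝒜, κ B * π B ≤ ∑ B ∈ 𝒜, π B :=
    Finset.sum_le_sum fun B hB => by
      have := mul_le_mul_of_nonneg_right (hκ1 B hB) (hπ B hB)
      rwa [one_mul] at this
  nlinarith [key, hle, mul_le_mul_of_nonneg_left hle ht]

end Summit.CriticalPhenomena.PercolationContinuityZ3.Theorems
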